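import Summits.CriticalPhenomena.PercolationContinuityZ3.Theorems.Transplant.Bcc111ClawFast
import HarnessLib

/-!
# The bcc (111)-films `F_m(bcc)`, exit-form routing certificate II⁵: the first-fit rule `clawH5` with BOTH extreme vertices of the hub column kept
# (for the thickness `m = 5`, where the elevator port `n` may be a top or bottom vertex) — statement `ClawHOK5` for the kernel, fast copy

builds on p205010 (kernel theorem, internal audit signed; external expert review pending) — NOT used in this file.
Lane `prim-bschramm`, seat `prim-bschramm-p2` (gen 48; class C1b, METHOD = input substitution; memo `HOME/bschramm/P2-LATTICES.md` §159); helper file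
(`--supports stmt-CriticalPhenomena-4575 --as helper`).  «Bcc111Route» covers `m ≥ 6`: at `m = 5` the up-hub over a column of base level `2` has its elevator port `n = (Q, 5)` at
the TOP level, where the model's hub test of «Bcc111ClawTable».`clawH` only guarantees that the BOTTOM vertex of `Q` is kept.  `clawH5` is the same rule over the same
candidate-leg table with the hub test strengthened to `¬rem0 Q ∧ ¬remM Q`; the oracle (HOME/prim-bschramm-p2-g48/oracle/lean_rule.py) confirms it still serves all `104 784`
configurations of the ten kernel classes, which «Bcc111ClawTable5OK*» re-establish by `decide +kernel` (fast copy `clawH5F`, equal on the kernel family).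
[cite: DuminilCopinSidoraviciusTassion2016, §2.3 (proof of Fact 2)]
-/

namespace Summit.CriticalPhenomena.PercolationContinuityZ3.Theorems.Transplant

namespace Bcc111Claw

open BccClawX (Pt)

/-- **The rule with both extreme vertices of the hub column kept** (otherwise verbatim «Bcc111ClawTable».`clawH`). [folklore] -/
def clawH5 (tR tD sR sD : ℕ) (a1 a2 a3 : Pt) (ty : ℕ) : Option (Pt × ℕ × Bool × ℕ × ℕ × ℕ × List Pt × List Pt × List Pt) :=
  let same : Bool := a1 == a2
  hubs.findSome? fun ⟨Q, i, up⟩ =>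
    let ⟨bc, F0, F1, X0, X1⟩ := hubCols Q i up
    if !inRB tR sR Q || !decide (tnZ Q ≤ 2) || Q == a1 || Q == a2 || Q == a3 || rem0 tR sR Q || remM tR sR Q ||
        !inRB tR sR bc || bc == a1 || bc == a2 || bc == a3 then none
    else
      assigns.findSome? fun ⟨j, k, xi⟩ =>
        let ⟨s1, s2, s3⟩ := starts F0 F1 X0 X1 j k xi
        let av1 : List Pt := if same then [Q, bc, a3] else [Q, bc, a2, a3]
        let av2 : List Pt := if same then [Q, bc, a3] else [Q, bc, a1, a3]
        let L1 := ((cand (a1.1 - s1.1, a1.2 - s1.2)).map (shiftTo s1)).filter fun l =>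
          legOK (inRB tR sR) av1 s1 a1 l && (!same || penLo tR sR a1 (ty / 3) (penult l))
        let L2 := ((cand (a2.1 - s2.1, a2.2 - s2.2)).map (shiftTo s2)).filter fun l =>
          legOK (inRB tR sR) av2 s2 a2 l && (!same || penHi tR sR a1 (ty % 3) (penult l))
        let L3 := ((cand (a3.1 - s3.1, a3.2 - s3.2)).map (shiftTo s3)).filter fun l => legOK (inDB tR tD sR sD) [Q, bc, a1, a2] s3 a3 l
        L1.findSome? fun l1 => L2.findSome? fun l2 =>
          if !disjH same a1 l1 l2 then none
          else (L3.find? fun l3 => disjH false a1 l3 l1 && disjH false a1 l3 l2).map fun l3 => (Q, i, up, j, k, xi, l1, l2, l3)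

/-- **The statement for one kernel class `(3, 3, s_R, s_D)`, column of `E₁` over `L`**, rule `clawH5`. [folklore] -/
def ClawHOKL5 (sR sD : ℕ) (L : List Pt) : Prop :=
  ∀ a1 ∈ L, certE 3 3 sR sD a1 = true → ∀ a2 ∈ hexPts, certE 3 3 sR sD a2 = true → ∀ a3 ∈ hexPts, certW 3 3 sR sD a1 a2 a3 = true →
    ∀ ty ∈ List.range 10, tyOK 3 sR a1 a2 ty = true → (clawH5 3 3 sR sD a1 a2 a3 ty).isSome = true

/-- **The statement for one kernel class**, rule `clawH5`. [folklore] -/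
def ClawHOK5 (sR sD : ℕ) : Prop := ClawHOKL5 sR sD hexPts

/-- Chunks assemble. [folklore] -/
theorem clawHOKL5_append {sR sD : ℕ} {L₁ L₂ : List Pt} (h₁ : ClawHOKL5 sR sD L₁) (h₂ : ClawHOKL5 sR sD L₂) : ClawHOKL5 sR sD (L₁ ++ L₂) := by
  intro a1 ha1
  rcases List.mem_append.1 ha1 with h | h
  · exact h₁ a1 h
  · exact h₂ a1 h

/-- `ClawHOK5` in terms of `admissible`. [folklore] -/
theorem clawH5_isSome_of_clawHOK5 {sR sD : ℕ} (h : ClawHOK5 sR sD) {a1 a2 a3 : Pt} (h1 : a1 ∈ hexPts) (h2 : a2 ∈ hexPts) (h3 : a3 ∈ hexPts) {ty : ℕ}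
    (hty : ty ∈ List.range 10) (hadm : admissible 3 3 sR sD a1 a2 a3 ty = true) : (clawH5 3 3 sR sD a1 a2 a3 ty).isSome = true := by
  rw [admissible_eq] at hadm
  simp only [Bool.and_eq_true] at hadm
  exact h a1 h1 hadm.1.1.1 a2 h2 hadm.1.1.2 a3 h3 hadm.1.2 ty hty hadm.2

/-- Fast copy of `clawH5` (pocket test skipped unless `s_R = 0`). [folklore] -/
def clawH5F (tR tD sR sD : ℕ) (a1 a2 a3 : Pt) (ty : ℕ) : Option (Pt × ℕ × Bool × ℕ × ℕ × ℕ × List Pt × List Pt × List Pt) :=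
  let same : Bool := a1 == a2
  hubs.findSome? fun ⟨Q, i, up⟩ =>
    let ⟨bc, F0, F1, X0, X1⟩ := hubCols Q i up
    if !inRBF tR sR Q || !decide (tnZ Q ≤ 2) || Q == a1 || Q == a2 || Q == a3 || rem0F tR sR Q || remMF tR sR Q ||
        !inRBF tR sR bc || bc == a1 || bc == a2 || bc == a3 then none
    else
      assigns.findSome? fun ⟨j, k, xi⟩ =>
        let ⟨s1, s2, s3⟩ := starts F0 F1 X0 X1 j k xi
        let av1 : List Pt := if same then [Q, bc, a3] else [Q, bc, a2, a3]
        let av2 : List Pt := if same then [Q, bc, a3] else [Q, bc, a1, a3]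
        let L1 := ((cand (a1.1 - s1.1, a1.2 - s1.2)).map (shiftTo s1)).filter fun l =>
          legOK (inRBF tR sR) av1 s1 a1 l && (!same || penLoF tR sR a1 (ty / 3) (penult l))
        let L2 := ((cand (a2.1 - s2.1, a2.2 - s2.2)).map (shiftTo s2)).filter fun l =>
          legOK (inRBF tR sR) av2 s2 a2 l && (!same || penHiF tR sR a1 (ty % 3) (penult l))
        let L3 := ((cand (a3.1 - s3.1, a3.2 - s3.2)).map (shiftTo s3)).filter fun l => legOK (inDBF tR tD sR sD) [Q, bc, a1, a2] s3 a3 l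
        L1.findSome? fun l1 => L2.findSome? fun l2 =>
          if !disjH same a1 l1 l2 then none
          else (L3.find? fun l3 => disjH false a1 l3 l1 && disjH false a1 l3 l2).map fun l3 => (Q, i, up, j, k, xi, l1, l2, l3)

/-- Fast `ClawHOKL5`. [folklore] -/
def ClawHOKL5F (sR sD : ℕ) (L : List Pt) : Prop :=
  ∀ a1 ∈ L, certEF 3 3 sR sD a1 = true → ∀ a2 ∈ hexPts, certEF 3 3 sR sD a2 = true → ∀ a3 ∈ hexPts, certWF 3 3 sR sD a1 a2 a3 = true →
    ∀ ty ∈ List.range 10, tyOKF 3 sR a1 a2 ty = true → (clawH5F 3 3 sR sD a1 a2 a3 ty).isSome = true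

/-- `clawH5F = clawH5` on the kernel family. [folklore] -/
theorem clawH5F_eq {tR tD sR sD : ℕ} (htR : tR = 3) (hsR : sR ≤ 3) : clawH5F tR tD sR sD = clawH5 tR tD sR sD := by
  funext a1 a2 a3 ty
  rw [clawH5F, clawH5, inRBF_eq htR hsR, inDBF_eq htR hsR, rem0F_eq htR hsR, remMF_eq htR hsR, penLoF_eq htR hsR, penHiF_eq htR hsR]

/-- **The fast statement is the model's statement** (rule `clawH5`). [folklore] -/
theorem clawHOKL5_iff_fast {sR sD : ℕ} (hsR : sR ≤ 3) (L : List Pt) : ClawHOKL5F sR sD L ↔ ClawHOKL5 sR sD L := by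
  unfold ClawHOKL5F ClawHOKL5
  rw [certEF_eq rfl hsR, certWF_eq rfl hsR, tyOKF_eq rfl hsR, clawH5F_eq rfl hsR]

end Bcc111Claw

end Summit.CriticalPhenomena.PercolationContinuityZ3.Theorems.Transplant
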